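import Mathlib

/-!
# NearestChildSlack — the SLACK half of the census-backed NEAREST-CHILD LAW
(C1 rh-idea-5 g28, W-08 law421 ring; words: `g28/scan/SCAN-REPORT-W08-C1-rh-idea-5-g28.md` v5 §Addendum 2)

Census (kit-free, poly×exp frames, legal geometry): on 10 672 / 10 672 mixed in-range LocalB windows the zero of
`F^{(j+1)}` NEAREST to the lowest band state `v` is a level-`(j+1)` band state, while `v`'s closed Jensen disc is
empty ("robbed") in 13–20 % of them — so the invariant is DISTANCE + SLACK, not nestedness.  Proof shape:
(i) DISTANCE (analytic, the remaining content): the nearest zero `u` of `F^{(j+1)}` satisfies `‖u - v‖ ≤ c · Im v`;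
(ii) SLACK (arithmetic, THIS FILE): a point within `c · Im v` of a LOW level-`j` band state satisfies the
level-`(j+1)` band inequality.  Everything is stated over bare `ℝ` / `ℂ` (Mathlib only, no tree imports) in the exact
functional form of the tree's band class `RhW08.QuadW.StColQ'`
(`(max (|u.re - x₀| - R / 2) 0) ^ 2 + j * u.im ^ 2 ≤ j * Hs ^ 2 ∧ u.im ≤ Hs`), so each lemma ports by `exact`.

* `rho_le_rho_add_norm`   — the lateral excess `ρ` is 1-Lipschitz;
* `im_le_im_add_norm`     — heights move by at most the distance;
* `succBand_of_slack`     — interface: band_j state `v`, `‖u - v‖ ≤ r`, explicit slack inequality ⇒ `u` satisfies band_{j+1};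
* `slack_arith_column`    — the slack inequality in the COLUMN regime (`ρ v = 0`) from `r ≤ c·y` and `y²((1+c)²+c²) ≤ Hs²`;
* `succBand_of_near_column` — (ii) assembled: column band state, distance `≤ c · Im v`, lowness ⇒ band_{j+1} inequality + height;
* `slack_arith_overhang` / `succBand_of_near_overhang` — the OVERHANG regime (`ρ v > 0` allowed) with the `j`-dependent lowness
  `ρ_v² + j y² ≤ j Hs²`, `r ≤ c·y`, `y² (2j + 1) ((1+c)² + 2c²) ≤ Hs²` (crude but explicit);
* `slack_arith_nonrising` / `succBand_of_near_nonrising` — the NON-RISING regime (`Im u ≤ Im v`, the typical one for the child of the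
  lowest zero): band_j(v), `‖u - v‖ ≤ r`, `Im v² + 2(2j+1) r² ≤ Hs²` ⇒ band_{j+1}(u) — no loss in the height term.

COVERAGE of the census data (`g28/scan/coverage_census.py`): nearest-child distance ratio `d = ‖u* - v‖ / Im v ≤ 1.34` on all
5 650 kept windows (93 % below 0.5); the column lemma with `c = d` covers every column case (3 419/3 419, 598/605); see the
SCAN-REPORT §Addendum 3 for the non-rising variant's coverage.

Nothing here bears on the truth of RH; `AntiEscapeCore` / 24774 / 33346 stay OPEN — this only removes the bookkeeping
from whoever proves the distance bound (i).
-/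

namespace RhW08.NearestChildSlack

/-- The lateral excess of `u` over the column `|Re u - x₀| ≤ R/2`. -/
noncomputable def rho (x₀ R : ℝ) (u : ℂ) : ℝ := max (|u.re - x₀| - R / 2) 0

/-- `ρ ≥ 0`. -/
theorem rho_nonneg (x₀ R : ℝ) (u : ℂ) : 0 ≤ rho x₀ R u := le_max_right _ _

/-- In the column the excess vanishes. -/
theorem rho_eq_zero_of_column (x₀ R : ℝ) (u : ℂ) (h : |u.re - x₀| ≤ R / 2) : rho x₀ R u = 0 := by
  unfold rho; exact max_eq_right (by linarith)

/-- `ρ` is 1-Lipschitz: `ρ u ≤ ρ v + ‖u - v‖`. -/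
theorem rho_le_rho_add_norm (x₀ R : ℝ) (u v : ℂ) : rho x₀ R u ≤ rho x₀ R v + ‖u - v‖ := by
  have h1 : |(u - v).re| ≤ ‖u - v‖ := Complex.abs_re_le_norm (u - v)
  rw [Complex.sub_re] at h1
  have h2 : |u.re - x₀| ≤ |v.re - x₀| + |u.re - v.re| := by
    calc |u.re - x₀| = |(v.re - x₀) + (u.re - v.re)| := by congr 1; ring
      _ ≤ |v.re - x₀| + |u.re - v.re| := abs_add_le _ _
  have hn : 0 ≤ ‖u - v‖ := norm_nonneg _
  unfold rho
  rcases le_or_gt 0 (|v.re - x₀| - R / 2) with hv | hv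
  · rw [max_eq_left hv]
    exact max_le (by linarith) (by linarith)
  · rw [max_eq_right hv.le]
    exact max_le (by linarith) (by linarith)

/-- Heights move by at most the distance: `Im u ≤ Im v + ‖u - v‖`. -/
theorem im_le_im_add_norm (u v : ℂ) : u.im ≤ v.im + ‖u - v‖ := by
  have h1 : |(u - v).im| ≤ ‖u - v‖ := Complex.abs_im_le_norm (u - v)
  rw [Complex.sub_im] at h1
  have h2 := le_abs_self (u.im - v.im)
  linarith

/-- INTERFACE.  If `u` is within `r` of `v` and the explicit SLACK inequality
`(ρ v + r)² + (j+1)(Im v + r)² ≤ (j+1) Hs²` holds, then `u` (with `Im u > 0`) satisfies the level-`(j+1)` band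
inequality and the height clause (for `Hs ≥ 0`). -/
theorem succBand_of_slack (j : ℕ) (x₀ R Hs r : ℝ) (u v : ℂ) (hHs : 0 ≤ Hs)
    (hdist : ‖u - v‖ ≤ r) (hu : 0 < u.im)
    (hslack : (rho x₀ R v + r) ^ 2 + ((j : ℝ) + 1) * (v.im + r) ^ 2 ≤ ((j : ℝ) + 1) * Hs ^ 2) :
    (max (|u.re - x₀| - R / 2) 0) ^ 2 + ((j : ℝ) + 1) * u.im ^ 2 ≤ ((j : ℝ) + 1) * Hs ^ 2 ∧ u.im ≤ Hs := by
  have hρu : 0 ≤ rho x₀ R u := rho_nonneg x₀ R u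
  have hρ : rho x₀ R u ≤ rho x₀ R v + r := le_trans (rho_le_rho_add_norm x₀ R u v) (by linarith)
  have him : u.im ≤ v.im + r := le_trans (im_le_im_add_norm u v) (by linarith)
  have hj : (0 : ℝ) ≤ (j : ℝ) := Nat.cast_nonneg j
  have e1 : (rho x₀ R u) ^ 2 ≤ (rho x₀ R v + r) ^ 2 := by nlinarith
  have e2 : u.im ^ 2 ≤ (v.im + r) ^ 2 := by nlinarith
  have e3 : ((j : ℝ) + 1) * u.im ^ 2 ≤ ((j : ℝ) + 1) * (v.im + r) ^ 2 :=
    mul_le_mul_of_nonneg_left e2 (by linarith)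
  have main : (rho x₀ R u) ^ 2 + ((j : ℝ) + 1) * u.im ^ 2 ≤ ((j : ℝ) + 1) * Hs ^ 2 := by linarith
  refine ⟨by simpa [rho] using main, ?_⟩
  -- height: (j+1) u.im² ≤ (j+1) Hs² ⇒ u.im ≤ Hs
  have h4 : u.im ^ 2 ≤ Hs ^ 2 := by
    have : ((j : ℝ) + 1) * u.im ^ 2 ≤ ((j : ℝ) + 1) * Hs ^ 2 := by nlinarith
    exact le_of_mul_le_mul_left this (by linarith)
  nlinarith [h4, hu, hHs]

/-- SLACK ARITHMETIC, column regime (`ρ v = 0`): `0 ≤ r ≤ c·y` and `y² ((1+c)² + c²) ≤ Hs²` give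
`r² + (j+1)(y+r)² ≤ (j+1) Hs²` for every `j`. -/
theorem slack_arith_column (j : ℕ) (y r c Hs : ℝ) (hy : 0 ≤ y) (hr0 : 0 ≤ r) (hr : r ≤ c * y)
    (hlow : y ^ 2 * ((1 + c) ^ 2 + c ^ 2) ≤ Hs ^ 2) :
    r ^ 2 + ((j : ℝ) + 1) * (y + r) ^ 2 ≤ ((j : ℝ) + 1) * Hs ^ 2 := by
  have hj : (0 : ℝ) ≤ (j : ℝ) := Nat.cast_nonneg j
  have hcy : 0 ≤ c * y := le_trans hr0 hr
  have e1 : r ^ 2 ≤ (c * y) ^ 2 := by nlinarith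
  have e2 : (y + r) ^ 2 ≤ ((1 + c) * y) ^ 2 := by nlinarith
  have e3 : ((j : ℝ) + 1) * (y + r) ^ 2 ≤ ((j : ℝ) + 1) * ((1 + c) * y) ^ 2 :=
    mul_le_mul_of_nonneg_left e2 (by linarith)
  have e4 : ((j : ℝ) + 1) * (y ^ 2 * ((1 + c) ^ 2 + c ^ 2)) ≤ ((j : ℝ) + 1) * Hs ^ 2 :=
    mul_le_mul_of_nonneg_left hlow (by linarith)
  have e5 : (c * y) ^ 2 ≤ ((j : ℝ) + 1) * (c * y) ^ 2 := by nlinarith [sq_nonneg (c * y)]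
  nlinarith

/-- (ii) ASSEMBLED, column regime.  A level-`j` band state `v` IN THE COLUMN (`|Re v - x₀| ≤ R/2`), a point `u` of the
upper half-plane within `c · Im v` of it, and the lowness `Im v² ((1+c)² + c²) ≤ Hs²` (e.g. `c = 1`: `Im v ≤ Hs/√5`;
`c = 2`: `Im v ≤ Hs/√13`) ⇒ `u` satisfies the level-`(j+1)` band inequality and `Im u ≤ Hs`.  With the DISTANCE bound
(i) for the nearest zero of `F^{(j+1)}` this is the successor band state of `AntiEscapeCore` in the low-column regime. -/
theorem succBand_of_near_column (j : ℕ) (x₀ R Hs c : ℝ) (u v : ℂ) (hHs : 0 ≤ Hs)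
    (hcol : |v.re - x₀| ≤ R / 2) (hv : 0 < v.im) (hu : 0 < u.im)
    (hdist : ‖u - v‖ ≤ c * v.im)
    (hlow : v.im ^ 2 * ((1 + c) ^ 2 + c ^ 2) ≤ Hs ^ 2) :
    (max (|u.re - x₀| - R / 2) 0) ^ 2 + ((j : ℝ) + 1) * u.im ^ 2 ≤ ((j : ℝ) + 1) * Hs ^ 2 ∧ u.im ≤ Hs := by
  have h0 : rho x₀ R v = 0 := rho_eq_zero_of_column x₀ R v hcol
  have hs := slack_arith_column j v.im (c * v.im) c Hs hv.le (le_trans (norm_nonneg _) hdist) le_rfl hlow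
  refine succBand_of_slack j x₀ R Hs (c * v.im) u v hHs hdist hu ?_
  rw [h0, zero_add]; exact hs

/-- SLACK ARITHMETIC, overhang regime: `ρ² + j y² ≤ j Hs²` (band_j), `0 ≤ r ≤ c·y`, and the `j`-dependent lowness
`y² (2j + 1) ((1+c)² + 2c²) ≤ Hs²` give `(ρ + r)² + (j+1)(y+r)² ≤ (j+1) Hs²` (via `(ρ+r)² ≤ 2ρ² + 2r²`; crude). -/
theorem slack_arith_overhang (j : ℕ) (ρ y r c Hs : ℝ) (hy : 0 ≤ y) (hr0 : 0 ≤ r) (hr : r ≤ c * y)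
    (hband : ρ ^ 2 + (j : ℝ) * y ^ 2 ≤ (j : ℝ) * Hs ^ 2)
    (hlow : y ^ 2 * (2 * (j : ℝ) + 1) * ((1 + c) ^ 2 + 2 * c ^ 2) ≤ Hs ^ 2) :
    (ρ + r) ^ 2 + ((j : ℝ) + 1) * (y + r) ^ 2 ≤ ((j : ℝ) + 1) * Hs ^ 2 := by
  have hj : (0 : ℝ) ≤ (j : ℝ) := Nat.cast_nonneg j
  have hcy : 0 ≤ c * y := le_trans hr0 hr
  have e0 : (ρ + r) ^ 2 ≤ 2 * ρ ^ 2 + 2 * r ^ 2 := by nlinarith [sq_nonneg (ρ - r)]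
  have e1 : r ^ 2 ≤ (c * y) ^ 2 := by nlinarith
  have e2 : (y + r) ^ 2 ≤ ((1 + c) * y) ^ 2 := by nlinarith
  have e3 : ((j : ℝ) + 1) * (y + r) ^ 2 ≤ ((j : ℝ) + 1) * ((1 + c) * y) ^ 2 :=
    mul_le_mul_of_nonneg_left e2 (by linarith)
  -- 2ρ² ≤ 2j(Hs² - y²); so LHS ≤ 2jHs² - 2jy² + 2c²y² + (j+1)(1+c)²y²; need ≤ (j+1)Hs², i.e.
  -- (j-1)Hs² + [2c² + (j+1)(1+c)² - 2j] y² ≤ 0 ... only for j = 0 directly; in general trade jHs² against hlow: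
  -- hlow ⇒ (2j+1)((1+c)²+2c²) y² ≤ Hs², and 2ρ² ≤ 2jHs² - 2jy² is too lossy for j ≥ 1, so use (ρ+r)² ≤ ρ² + (2ρ r + r²)
  -- with 2ρr ≤ ρ²/(j... — keep it crude but TRUE: use instead (ρ + r)² ≤ (1 + 1/(2j+1))... we avoid division:
  -- (2j+1)(ρ+r)² ≤ (2j+2)ρ² + (2j+2)(2j+1) r²  [AM-GM: 2ρr(2j+1) ≤ ρ² + (2j+1)² r²].
  have e4 : (2 * (j : ℝ) + 1) * (ρ + r) ^ 2 ≤ (2 * (j : ℝ) + 2) * ρ ^ 2 + (2 * (j : ℝ) + 2) * (2 * (j : ℝ) + 1) * r ^ 2 := by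
    nlinarith [sq_nonneg (ρ - (2 * (j : ℝ) + 1) * r), sq_nonneg r, sq_nonneg ρ]
  -- multiply the goal by (2j+1) > 0 and combine: (2j+2)ρ² ≤ (2j+2) j (Hs² - y²)
  have e5 : (2 * (j : ℝ) + 2) * ρ ^ 2 ≤ (2 * (j : ℝ) + 2) * ((j : ℝ) * Hs ^ 2 - (j : ℝ) * y ^ 2) := by
    apply mul_le_mul_of_nonneg_left _ (by linarith); linarith
  have e6 : (2 * (j : ℝ) + 2) * (2 * (j : ℝ) + 1) * r ^ 2 ≤ (2 * (j : ℝ) + 2) * (2 * (j : ℝ) + 1) * (c * y) ^ 2 :=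
    mul_le_mul_of_nonneg_left e1 (by nlinarith)
  have e7 : (2 * (j : ℝ) + 1) * (((j : ℝ) + 1) * (y + r) ^ 2) ≤ (2 * (j : ℝ) + 1) * (((j : ℝ) + 1) * ((1 + c) * y) ^ 2) :=
    mul_le_mul_of_nonneg_left e3 (by linarith)
  have e8 : ((j : ℝ) + 1) * (y ^ 2 * (2 * (j : ℝ) + 1) * ((1 + c) ^ 2 + 2 * c ^ 2)) ≤ ((j : ℝ) + 1) * Hs ^ 2 :=
    mul_le_mul_of_nonneg_left hlow (by linarith)
  -- target × (2j+1):  (2j+1)[(ρ+r)² + (j+1)(y+r)²] ≤ (2j+1)(j+1)Hs²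
  have key : (2 * (j : ℝ) + 1) * ((ρ + r) ^ 2 + ((j : ℝ) + 1) * (y + r) ^ 2) ≤ (2 * (j : ℝ) + 1) * (((j : ℝ) + 1) * Hs ^ 2) := by
    nlinarith [sq_nonneg y, sq_nonneg c, sq_nonneg (c * y), sq_nonneg Hs, sq_nonneg ((j : ℝ) * y), mul_nonneg hj (sq_nonneg y)]
  exact le_of_mul_le_mul_left key (by linarith)

/-- (ii) ASSEMBLED, overhang regime: a level-`j` band state `v` (column OR overhang: `ρ_v² + j Im v² ≤ j Hs²`), `u` in the
upper half-plane within `c · Im v`, and the lowness `Im v² (2j+1)((1+c)² + 2c²) ≤ Hs²` ⇒ `u` satisfies band_{j+1}. -/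
theorem succBand_of_near_overhang (j : ℕ) (x₀ R Hs c : ℝ) (u v : ℂ) (hHs : 0 ≤ Hs)
    (hband : (max (|v.re - x₀| - R / 2) 0) ^ 2 + (j : ℝ) * v.im ^ 2 ≤ (j : ℝ) * Hs ^ 2)
    (hv : 0 < v.im) (hu : 0 < u.im) (hdist : ‖u - v‖ ≤ c * v.im)
    (hlow : v.im ^ 2 * (2 * (j : ℝ) + 1) * ((1 + c) ^ 2 + 2 * c ^ 2) ≤ Hs ^ 2) :
    (max (|u.re - x₀| - R / 2) 0) ^ 2 + ((j : ℝ) + 1) * u.im ^ 2 ≤ ((j : ℝ) + 1) * Hs ^ 2 ∧ u.im ≤ Hs := by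
  have hs := slack_arith_overhang j (rho x₀ R v) v.im (c * v.im) c Hs hv.le
    (le_trans (norm_nonneg _) hdist) le_rfl (by simpa [rho] using hband) hlow
  exact succBand_of_slack j x₀ R Hs (c * v.im) u v hHs hdist hu hs

/-- SLACK ARITHMETIC, non-rising regime (the typical one: the nearest child of the LOWEST zero sits at or below it).
`ρ² + j y² ≤ j Hs²` (band_j) and the `j`-mild lowness `y² + 2(2j+1) r² ≤ Hs²` give `(ρ + r)² + (j+1) y² ≤ (j+1) Hs²`
(no loss in the height term; AM–GM `2(2j+1)ρr ≤ ρ² + (2j+1)² r²` avoids both `√j` and the case `j = 0`). -/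
theorem slack_arith_nonrising (j : ℕ) (ρ y r Hs : ℝ)
    (hband : ρ ^ 2 + (j : ℝ) * y ^ 2 ≤ (j : ℝ) * Hs ^ 2)
    (hlow : y ^ 2 + 2 * (2 * (j : ℝ) + 1) * r ^ 2 ≤ Hs ^ 2) :
    (ρ + r) ^ 2 + ((j : ℝ) + 1) * y ^ 2 ≤ ((j : ℝ) + 1) * Hs ^ 2 := by
  have hj : (0 : ℝ) ≤ (j : ℝ) := Nat.cast_nonneg j
  have e4 : (2 * (j : ℝ) + 1) * (ρ + r) ^ 2 ≤ (2 * (j : ℝ) + 2) * ρ ^ 2 + (2 * (j : ℝ) + 2) * (2 * (j : ℝ) + 1) * r ^ 2 := by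
    nlinarith [sq_nonneg (ρ - (2 * (j : ℝ) + 1) * r), sq_nonneg r, sq_nonneg ρ]
  have e5 : (2 * (j : ℝ) + 2) * ρ ^ 2 ≤ (2 * (j : ℝ) + 2) * ((j : ℝ) * Hs ^ 2 - (j : ℝ) * y ^ 2) := by
    apply mul_le_mul_of_nonneg_left _ (by linarith); linarith
  have e8 : ((j : ℝ) + 1) * (y ^ 2 + 2 * (2 * (j : ℝ) + 1) * r ^ 2) ≤ ((j : ℝ) + 1) * Hs ^ 2 :=
    mul_le_mul_of_nonneg_left hlow (by linarith)
  have key : (2 * (j : ℝ) + 1) * ((ρ + r) ^ 2 + ((j : ℝ) + 1) * y ^ 2) ≤ (2 * (j : ℝ) + 1) * (((j : ℝ) + 1) * Hs ^ 2) := by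
    nlinarith [sq_nonneg y, sq_nonneg r, sq_nonneg Hs, mul_nonneg hj (sq_nonneg y), mul_nonneg hj (sq_nonneg r)]
  exact le_of_mul_le_mul_left key (by linarith)

/-- (ii) ASSEMBLED, non-rising regime: a level-`j` band state `v` (column or overhang), a point `u` with `0 < Im u ≤ Im v`
within `r` of `v`, and `Im v² + 2(2j+1) r² ≤ Hs²` ⇒ `u` satisfies band_{j+1} and the height clause.  (Coverage of the census
data: see the module docstring.) -/
theorem succBand_of_near_nonrising (j : ℕ) (x₀ R Hs r : ℝ) (u v : ℂ) (hHs : 0 ≤ Hs)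
    (hband : (max (|v.re - x₀| - R / 2) 0) ^ 2 + (j : ℝ) * v.im ^ 2 ≤ (j : ℝ) * Hs ^ 2)
    (hu : 0 < u.im) (hur : u.im ≤ v.im) (hdist : ‖u - v‖ ≤ r)
    (hlow : v.im ^ 2 + 2 * (2 * (j : ℝ) + 1) * r ^ 2 ≤ Hs ^ 2) :
    (max (|u.re - x₀| - R / 2) 0) ^ 2 + ((j : ℝ) + 1) * u.im ^ 2 ≤ ((j : ℝ) + 1) * Hs ^ 2 ∧ u.im ≤ Hs := by
  have hs := slack_arith_nonrising j (rho x₀ R v) v.im r Hs (by simpa [rho] using hband) hlow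
  have hρu : 0 ≤ rho x₀ R u := rho_nonneg x₀ R u
  have hρ : rho x₀ R u ≤ rho x₀ R v + r := le_trans (rho_le_rho_add_norm x₀ R u v) (by linarith)
  have hj : (0 : ℝ) ≤ (j : ℝ) := Nat.cast_nonneg j
  have e1 : (rho x₀ R u) ^ 2 ≤ (rho x₀ R v + r) ^ 2 := by nlinarith
  have e2 : u.im ^ 2 ≤ v.im ^ 2 := by nlinarith
  have e3 : ((j : ℝ) + 1) * u.im ^ 2 ≤ ((j : ℝ) + 1) * v.im ^ 2 := mul_le_mul_of_nonneg_left e2 (by linarith)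
  have main : (rho x₀ R u) ^ 2 + ((j : ℝ) + 1) * u.im ^ 2 ≤ ((j : ℝ) + 1) * Hs ^ 2 := by linarith
  refine ⟨by simpa [rho] using main, ?_⟩
  have h4 : v.im ^ 2 ≤ Hs ^ 2 := by nlinarith [sq_nonneg r]
  nlinarith [h4, hu, hHs, hur]

/-- Sanity instance of the column lowness constant: `c = 1` needs `5 · Im v² ≤ Hs²`. -/
example (y Hs : ℝ) (h : 5 * y ^ 2 ≤ Hs ^ 2) : y ^ 2 * ((1 + (1:ℝ)) ^ 2 + (1:ℝ) ^ 2) ≤ Hs ^ 2 := by nlinarith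

end RhW08.NearestChildSlack
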